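import Summits.Ventures.PercRepro.C041CutSplitGood
import Summits.Ventures.PercRepro.C041CutGlueBound

/-!
# LEMMA G on zone port problems: `Φ∨` of a loose problem with a cut vertex is the glue of its two sides
(p6, gen 25; C-041.md §9)

For a split `sp` of a loose problem `L` at `u`: the GADGET SPACE `sp.gadget` (states = the gadget-side patterns,
weight `[Adm₁]`, bits `G₁'`, `G₂'`, validity `X₁' ∨ X₂'`) and the FAR SPACE `sp.far` (states = the far-side
patterns rooted at `u`, weight `[Adm₂]`, bits `G₁''`, `G₂''`, validity `X₁'' ∨ X₂''`) are `CutGlue.Space`s, and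

  **`phiOr_eq_glue`**: `Φ∨ L = (glue sp.gadget sp.ρ₁ sp.ρ₂ sp.far).phi`

— the patterns of `L` are the pairs (`splitEquiv`), admissibility and validity split (`adm_iff`, `X₁_iff`,
`X₂_iff`), and the weight is the glue's weight by `good₁_iff` / `good₂_iff`.  Hence the identity, the bound and
LEMMA G of `C041CutGlue*` hold for `Φ∨` of every zone port problem with a cut vertex (`phiOr_eq`, `phiOr_ge`,
`phiOr_nonneg_of_star`), in particular for every `Problem` (`Problem.phiOr_eq_glue`).  This is the graph-side
instance of §9's pairing on a SINGLE layer; the O-cube (several layers) is the sum of such identities over the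
layers, with a common far space — not assembled here.
-/

namespace PercRepro

namespace ZonePort

namespace Loose

namespace Split

open Finset CutGlue

variable {V E : Type*} {L : Loose V E} (sp : L.Split)

/-- Some red 1-edge of the gadget side. -/
def X₁' (x₁ : sp.Term₁ → Bool) : Prop := ∃ e : sp.Term₁, L.ts e.1.1 = false ∧ x₁ e = true

/-- Some red 2-edge of the gadget side. -/
def X₂' (x₁ : sp.Term₁ → Bool) : Prop := ∃ e : sp.Term₁, L.ts e.1.1 = true ∧ x₁ e = true

/-- Some red 1-edge of the far side. -/
def X₁'' (x₂ : sp.Term₂ → Bool) : Prop := ∃ e : sp.Term₂, L.ts e.1.1 = false ∧ x₂ e = true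

/-- Some red 2-edge of the far side. -/
def X₂'' (x₂ : sp.Term₂ → Bool) : Prop := ∃ e : sp.Term₂, L.ts e.1.1 = true ∧ x₂ e = true

/-- Admissibility of a gadget-side pattern. -/
def Adm₁ (x₁ : sp.Term₁ → Bool) : Prop :=
  (∀ e : sp.Term₁, L.sw (L.tz e.1.1) = false → x₁ e = true) ∧
  (∀ e f : sp.Term₁, L.tz e.1.1 = L.tz f.1.1 → L.ts e.1.1 = false → L.ts f.1.1 = true →
    x₁ e = true ∨ x₁ f = true)

/-- Admissibility of a far-side pattern. -/
def Adm₂ (x₂ : sp.Term₂ → Bool) : Prop :=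
  (∀ e : sp.Term₂, L.sw (L.tz e.1.1) = false → x₂ e = true) ∧
  (∀ e f : sp.Term₂, L.tz e.1.1 = L.tz f.1.1 → L.ts e.1.1 = false → L.ts f.1.1 = true →
    x₂ e = true ∨ x₂ f = true)

/-- `G₁'` gives a red 2-edge. -/
theorem X₂'_of_G₁' {x₁ : sp.Term₁ → Bool} (h : sp.G₁' x₁) : sp.X₂' x₁ := by
  obtain ⟨e, hts, hxe, _⟩ := h
  exact ⟨e, hts, hxe⟩

/-- `G₂'` gives a red 1-edge. -/
theorem X₁'_of_G₂' {x₁ : sp.Term₁ → Bool} (h : sp.G₂' x₁) : sp.X₁' x₁ := by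
  obtain ⟨e, hts, hxe, _⟩ := h
  exact ⟨e, hts, hxe⟩

/-- `G₁''` gives a red 2-edge. -/
theorem X₂''_of_G₁'' {x₂ : sp.Term₂ → Bool} (h : sp.G₁'' x₂) : sp.X₂'' x₂ := by
  obtain ⟨e, hts, hxe, _⟩ := h
  exact ⟨e, hts, hxe⟩

/-- `G₂''` gives a red 1-edge. -/
theorem X₁''_of_G₂'' {x₂ : sp.Term₂ → Bool} (h : sp.G₂'' x₂) : sp.X₁'' x₂ := by
  obtain ⟨e, hts, hxe, _⟩ := h
  exact ⟨e, hts, hxe⟩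

/-- `X₁` splits. -/
theorem X₁_iff (x : L.Term → Bool) : L.X₁ x ↔ sp.X₁' (sp.res₁ x) ∨ sp.X₁'' (sp.res₂ x) := by
  constructor
  · rintro ⟨e, hts, hxe⟩
    by_cases he : sp.InS₁ e
    · exact Or.inl ⟨⟨e, he⟩, hts, hxe⟩
    · exact Or.inr ⟨⟨e, he⟩, hts, hxe⟩
  · rintro (⟨e, hts, hxe⟩ | ⟨e, hts, hxe⟩)
    · exact ⟨e.1, hts, hxe⟩
    · exact ⟨e.1, hts, hxe⟩

/-- `X₂` splits. -/
theorem X₂_iff (x : L.Term → Bool) : L.X₂ x ↔ sp.X₂' (sp.res₁ x) ∨ sp.X₂'' (sp.res₂ x) := by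
  constructor
  · rintro ⟨e, hts, hxe⟩
    by_cases he : sp.InS₁ e
    · exact Or.inl ⟨⟨e, he⟩, hts, hxe⟩
    · exact Or.inr ⟨⟨e, he⟩, hts, hxe⟩
  · rintro (⟨e, hts, hxe⟩ | ⟨e, hts, hxe⟩)
    · exact ⟨e.1, hts, hxe⟩
    · exact ⟨e.1, hts, hxe⟩

/-- Admissibility splits: the zone of a pair of edges with the same zone lies on one side. -/
theorem adm_iff (x : L.Term → Bool) : L.Adm x ↔ sp.Adm₁ (sp.res₁ x) ∧ sp.Adm₂ (sp.res₂ x) := by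
  constructor
  · rintro ⟨h1, h2⟩
    exact ⟨⟨fun e he => h1 e.1 he, fun e f hef he hf => h2 e.1 f.1 hef he hf⟩,
      ⟨fun e he => h1 e.1 he, fun e f hef he hf => h2 e.1 f.1 hef he hf⟩⟩
  · rintro ⟨⟨h1, h2⟩, ⟨h3, h4⟩⟩
    refine ⟨fun e he => ?_, fun e f hef he hf => ?_⟩
    · by_cases hs : sp.InS₁ e
      · exact h1 ⟨e, hs⟩ he
      · exact h3 ⟨e, hs⟩ he
    · by_cases hs : sp.InS₁ e
      · have hs' : sp.InS₁ f := by
          unfold InS₁ at hs ⊢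
          rw [← hef]
          exact hs
        exact h2 ⟨e, hs⟩ ⟨f, hs'⟩ hef he hf
      · have hs' : ¬ sp.InS₁ f := by
          unfold InS₁ at hs ⊢
          rw [← hef]
          exact hs
        exact h4 ⟨e, hs⟩ ⟨f, hs'⟩ hef he hf

open Classical in
/-- **The gadget space** of the split: the gadget-side patterns, weighted by admissibility. -/
noncomputable def gadget : Space (sp.Term₁ → Bool) where
  w x₁ := if sp.Adm₁ x₁ then 1 else 0
  G₁ := sp.G₁'
  G₂ := sp.G₂'
  V x₁ := sp.X₁' x₁ ∨ sp.X₂' x₁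
  hG₁ _ h := Or.inr (sp.X₂'_of_G₁' h)
  hG₂ _ h := Or.inl (sp.X₁'_of_G₂' h)

open Classical in
/-- **The far space** of the split: the far-side patterns rooted at `u`, weighted by admissibility. -/
noncomputable def far : Space (sp.Term₂ → Bool) where
  w x₂ := if sp.Adm₂ x₂ then 1 else 0
  G₁ := sp.G₁''
  G₂ := sp.G₂''
  V x₂ := sp.X₁'' x₂ ∨ sp.X₂'' x₂
  hG₁ _ h := Or.inr (sp.X₂''_of_G₁'' h)
  hG₂ _ h := Or.inl (sp.X₁''_of_G₂'' h)

open Classical in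
/-- The patterns of `L` are the pairs of side patterns. -/
noncomputable def splitEquiv : (L.Term → Bool) ≃ (sp.Term₁ → Bool) × (sp.Term₂ → Bool) where
  toFun x := (sp.res₁ x, sp.res₂ x)
  invFun p := fun e => if h : sp.InS₁ e then p.1 ⟨e, h⟩ else p.2 ⟨e, h⟩
  left_inv x := by
    funext e
    by_cases h : sp.InS₁ e
    · simp [res₁, h]
    · simp [res₂, h]
  right_inv p := by
    refine Prod.ext (funext fun e => ?_) (funext fun e => ?_)
    · simp [res₁, e.2]
    · simp [res₂, e.2]

/-- An `if … then 3 else 0` is `3` times the indicator. -/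
theorem ite_three_eq (p : Prop) [Decidable p] : (if p then (3 : ℤ) else 0) = 3 * ind p := by
  by_cases h : p
  · rw [if_pos h, ind_pos h]
    norm_num
  · rw [if_neg h, ind_neg h]
    norm_num

open Classical in
/-- The weight of a pattern is the glue's weight of its pair. -/
theorem weight_eq (x : L.Term → Bool) :
    L.weight x = (glue sp.gadget sp.ρ₁ sp.ρ₂ sp.far).wt (sp.res₁ x, sp.res₂ x) := by
  unfold Loose.weight Space.wt
  rw [ite_three_eq, ite_three_eq]
  have h1 : L.Good₁ x ↔ (glue sp.gadget sp.ρ₁ sp.ρ₂ sp.far).G₁ (sp.res₁ x, sp.res₂ x) := by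
    rw [glue_G₁]
    exact sp.good₁_iff x
  have h2 : L.Good₂ x ↔ (glue sp.gadget sp.ρ₁ sp.ρ₂ sp.far).G₂ (sp.res₁ x, sp.res₂ x) := by
    rw [glue_G₂]
    exact sp.good₂_iff x
  rw [h1, h2]

section Sums

variable [Fintype E] [DecidableEq E] [DecidableEq V]

open Classical in
/-- **LEMMA G ON ZONE PORT PROBLEMS, the pairing**: `Φ∨ L` is the weight sum of the glue of the two sides. -/
theorem phiOr_eq_glue : L.phiOr = (glue sp.gadget sp.ρ₁ sp.ρ₂ sp.far).phi := by
  unfold Loose.phiOr Space.phi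
  refine Fintype.sum_equiv sp.splitEquiv _ _ fun x => ?_
  show (if L.Adm x ∧ (L.X₁ x ∨ L.X₂ x) then L.weight x else 0)
    = if (glue sp.gadget sp.ρ₁ sp.ρ₂ sp.far).V (sp.res₁ x, sp.res₂ x) then
        (((glue sp.gadget sp.ρ₁ sp.ρ₂ sp.far).w (sp.res₁ x, sp.res₂ x) : ℕ) : ℤ) *
          (glue sp.gadget sp.ρ₁ sp.ρ₂ sp.far).wt (sp.res₁ x, sp.res₂ x) else 0
  have hV : (glue sp.gadget sp.ρ₁ sp.ρ₂ sp.far).V (sp.res₁ x, sp.res₂ x) ↔ L.X₁ x ∨ L.X₂ x := by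
    rw [glue_V, sp.X₁_iff, sp.X₂_iff]
    show (sp.X₁' (sp.res₁ x) ∨ sp.X₂' (sp.res₁ x)) ∨ (sp.X₁'' (sp.res₂ x) ∨ sp.X₂'' (sp.res₂ x)) ↔ _
    tauto
  have hw : (glue sp.gadget sp.ρ₁ sp.ρ₂ sp.far).w (sp.res₁ x, sp.res₂ x)
      = (if sp.Adm₁ (sp.res₁ x) then 1 else 0) * (if sp.Adm₂ (sp.res₂ x) then 1 else 0) := rfl
  by_cases hA : L.Adm x
  · have hA' := (sp.adm_iff x).1 hA
    rw [hw, if_pos hA'.1, if_pos hA'.2]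
    by_cases hX : L.X₁ x ∨ L.X₂ x
    · rw [if_pos ⟨hA, hX⟩, if_pos (hV.2 hX), sp.weight_eq x]
      push_cast
      ring
    · rw [if_neg (fun h => hX h.2), if_neg (fun h => hX (hV.1 h))]
  · rw [if_neg (fun h => hA h.1), hw]
    have h0 : (if sp.Adm₁ (sp.res₁ x) then 1 else 0) * (if sp.Adm₂ (sp.res₂ x) then 1 else 0) = 0 := by
      by_cases h1 : sp.Adm₁ (sp.res₁ x)
      · have h2 : ¬ sp.Adm₂ (sp.res₂ x) := fun h2 => hA ((sp.adm_iff x).2 ⟨h1, h2⟩)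
        rw [if_neg h2, mul_zero]
      · rw [if_neg h1, zero_mul]
    rw [h0]
    split_ifs <;> simp

open Classical in
/-- **THE IDENTITY OF LEMMA G for `Φ∨`** of a zone port problem with a cut vertex. -/
theorem phiOr_eq : L.phiOr = sp.gadget.phi * sp.far.NnotV + ∑ x₂, (if sp.far.V x₂ then
    (sp.far.w x₂ : ℤ) * (sp.gadget.phiAll + 3 * sp.gadget.m₁ sp.ρ₁ * ind (sp.far.G₁ x₂)
      + 3 * sp.gadget.m₂ sp.ρ₂ * ind (sp.far.G₂ x₂)) else 0) := by
  rw [sp.phiOr_eq_glue, phi_glue]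

open Classical in
/-- **THE BOUND OF LEMMA G for `Φ∨`**. -/
theorem phiOr_ge {α : ℤ} (h₁ : α ≤ sp.gadget.m₁ sp.ρ₁) (h₂ : α ≤ sp.gadget.m₂ sp.ρ₂) :
    α * sp.far.phi + (sp.gadget.phiAll + 2 * α) * sp.far.NV + sp.gadget.phi * sp.far.NnotV ≤ L.phiOr := by
  rw [sp.phiOr_eq_glue]
  exact phi_glue_ge sp.gadget sp.ρ₁ sp.ρ₂ sp.far h₁ h₂

open Classical in
/-- **LEMMA G for `Φ∨`**: the criterion (★) on the gadget side together with `Φ ≥ 0` on both sides gives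
`Φ∨ L ≥ 0`. -/
theorem phiOr_nonneg_of_star (hP : 0 ≤ sp.gadget.phi) (hQ : 0 ≤ sp.far.phi)
    (hstar : 0 ≤ sp.gadget.phiAll + 2 * min (sp.gadget.m₁ sp.ρ₁) (sp.gadget.m₂ sp.ρ₂)) : 0 ≤ L.phiOr := by
  rw [sp.phiOr_eq_glue]
  exact phi_glue_nonneg_of_star sp.gadget sp.ρ₁ sp.ρ₂ sp.far hP hQ hstar

end Sums

end Split

end Loose

namespace Problem

variable {V E : Type*} [Fintype E] [DecidableEq E] [DecidableEq V]

open Classical in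
/-- **LEMMA G's pairing for a `Problem`**: `Φ∨ P` is the glue of the two sides of any split of `P.toLoose`. -/
theorem phiOr_eq_glue (P : Problem V E) (sp : P.toLoose.Split) :
    P.phiOr = (CutGlue.glue sp.gadget sp.ρ₁ sp.ρ₂ sp.far).phi := by
  rw [← P.phiOr_toLoose]
  exact sp.phiOr_eq_glue

end Problem

end ZonePort

end PercRepro
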